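import Summits.Schanuel.Schanuel.Theorems.ZilberEacIrrationalPoleFibre
import Summits.Schanuel.Schanuel.Theorems.ZilberEacIrrationalPhaseBranch
import Summits.Schanuel.Schanuel.Theorems.ZilberEacPlaneCurvePolyFibres
import Summits.Schanuel.Schanuel.Theorems.ZilberEacFibreBranch
import HarnessLib

/-!
# Arbitrary base branches, LXXIII: plane curves with a SIMPLE REAL IRRATIONAL ASYMPTOTIC DIRECTION —
# every polynomial fibre is in Mantova–Masser's case and dense; the hyperbola `x₁² = 2x₀² + 1`

HONEST FRAMING.  Cell `pub-schanuel` (Zilber's Exponential-Algebraic Closedness, case ladder;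
host summit Schanuel), seat 2, gen 32.  After gen 31 the undecided polynomial-fibre surfaces
`{F(x₀, x₁) = 0, y₀ = R(x₀, x₁)}` (`F` irreducible of `x₁`-degree `≥ 2`) were those ALL of whose
places over `x₀ = ∞` are unbounded with a bad direction datum, not asymptotic to a line of rational
slope and not rescued by an `SL₂(ℤ)` shear — the simplest being the hyperbola `x₁² = 2x₀² + 1` with
asymptotic slopes `±√2`.  This file settles the REAL IRRATIONAL directions:
* **`exists_place_of_simpleAsymptote`** — a simple nonzero root `θ` of the top form
  `T(t) = F_N(1, t)` (top row of `Q(s, t) = F(s, st)`) is the direction of an UNRAMIFIED place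
  `x₀ = 1/s`, `x₁ = Φ(s)/s`, `Φ(0) = θ` (implicit function theorem, file `ZilberEacFibreBranch`);
* **`unprojectedDense_branch_irrational_one`** — along such a place with `θ = a ∈ ℝ ∖ ℚ` every
  cylinder germ with fibre value `ψ(s)s^L` is dense: `L ≠ 0` by THEOREM I (file LXXI: the growth
  exponents `−L` and `−aL` of `log‖y₀‖`, `log‖y₁‖` against `log n` are `ℤ`-independent), `L = 0` by
  the growth/Kronecker dichotomy (file LXXII: the top phase `2πia` is non-resonant);
* **`unprojectedDensityQuestion_planeCurve_polyFibre_irrationalAsymptote`** — hence for EVERY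
  `R ∈ ℂ[x₀, x₁]` not vanishing on the curve, `{F = 0, y₀ = R}` is in Mantova–Masser's case
  (`dim π_add = 1`, no vertical line, free) AND has Zariski-dense exponential points; likewise
  rational fibres (**`unprojectedDense_planeCurve_rationalFibre_irrationalAsymptote`**);
* **`unprojectedDensityQuestion_hyperbolaSqrtTwo_polyFibre`** / **`_fibre_x₀`** — the hyperbola
  `x₁² = 2x₀² + 1` (top form `t² − 2`, simple roots `±√2`): every polynomial fibre case ∧ dense.
No direction condition, no growth, no transcendence input: irrationality alone.  What remains of
the bad-direction class after this file: real irrational directions that are MULTIPLE roots of the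
top form (ramified equal-order places), and the resonant residue class (`Φ(0)z^M ∈ 2πiℚ`).
Decided instances of an OPEN question (Mantova–Masser, PLMS 2024 §1 p. 5); EC(3,2) OPEN; NOT
Schanuel's conjecture (neither used nor implied); EAC ⇏ SC.
-/

noncomputable section

open Filter Topology Set Complex Polynomial
open Literature.NumberTheory.Transcendental Literature.ModelTheory.Zilber
open Literature.ModelTheory.ExponentialFields

set_option linter.dupNamespace false

namespace Summit.Schanuel.Schanuel.Theorems

/-! ## Part A. The germ: any fibre value along an unramified real-irrational place -/

/-- **Unramified place with a real IRRATIONAL direction: every fibre value is dense.**  A cylinder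
germ `(1/s, Φ(s)/s, ψ(s)s^L, e^{x₁})` (`ψ(0) ≠ 0`, `Φ(0) = a ∈ ℝ ∖ ℚ`, any `L ∈ ℤ`) in an irreducible
closed `S` of dimension `≤ 2` has `I(S ∩ Γ_exp) = I(S)`: `L ≠ 0` by file LXXI (THEOREM I), `L = 0`
by file LXXII (growth/Kronecker dichotomy).
[cite: MantovaMasser2023, §1 Further remarks, p. 5 (the question, open in general)] (new) -/
theorem unprojectedDense_branch_irrational_one {S : Set (Fin 2 ⊕ Fin 2 → ℂ)}
    (hS : IsIrreducibleClosed ℂ S) (hdim : zariskiDim ℂ S ≤ (2 : ℕ))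
    (L : ℤ) {ψ : ℂ → ℂ} (hψ : AnalyticAt ℂ ψ 0) (hψ0 : ψ 0 ≠ 0)
    {Φ : ℂ → ℂ} (hΦ : AnalyticAt ℂ Φ 0) {a : ℝ} (ha : Irrational a) (hΦ0 : Φ 0 = a)
    (hgerm : ∀ᶠ s in 𝓝[≠] (0 : ℂ),
      (Sum.elim ![(s ^ 1)⁻¹, Φ s * (s ^ 1)⁻¹] ![ψ s * s ^ L, Complex.exp (Φ s * (s ^ 1)⁻¹)] :
        Fin 2 ⊕ Fin 2 → ℂ) ∈ S) :
    UnprojectedDense S := by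
  rcases eq_or_ne L 0 with rfl | hL
  · refine unprojectedDense_branch_unitFibre_irrational hS hdim le_rfl hψ hψ0 rfl hΦ ha hΦ0 ?_
    filter_upwards [hgerm] with s hs
    rwa [zpow_zero, mul_one] at hs
  · exact unprojectedDense_branch_poleFibre_irrational_one hS hdim hL hψ hψ0 hΦ ha hΦ0 hgerm

/-! ## Part B. The place at a simple root of the top form -/

section PlaneCurve

variable (F : ℂ[X][X])

/-- **The unramified place at a simple asymptotic direction.**  Let `Q(s, t) = F(s, st)` have rows
of degree `≤ N` and top row `T` (`T_j = [s^N] q_j`, i.e. `T(t) = F_N(1, t)` for the top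
homogeneous form `F_N` of `F`).  A SIMPLE nonzero root `θ` of `T` is the direction of a place
`x₀ = 1/s`, `x₁ = Φ(s)/s` of the curve `F = 0` with `Φ` analytic at `0`, `Φ(0) = θ` (implicit
function theorem). [folklore] -/
theorem exists_place_of_simpleAsymptote (Q : ℂ[X][X])
    (hQ : ∀ s t : ℂ, (Q.map (Polynomial.evalRingHom s)).eval t =
      (F.map (Polynomial.evalRingHom s)).eval (s * t))
    (N : ℕ) (hN : ∀ j, (Q.coeff j).natDegree ≤ N) (T : ℂ[X]) (hT : ∀ j, T.coeff j = (Q.coeff j).coeff N)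
    {θ : ℂ} (hθ0 : θ ≠ 0) (hTθ : T.IsRoot θ) (hT'θ : (derivative T).eval θ ≠ 0) :
    ∃ Φ : ℂ → ℂ, AnalyticAt ℂ Φ 0 ∧ Φ 0 = θ ∧
      ∀ᶠ s in 𝓝[≠] (0 : ℂ),
        (F.map (Polynomial.evalRingHom (s ^ 1)⁻¹)).eval (Φ s * (s ^ 1)⁻¹) = 0 := by
  obtain ⟨Φ, δ, hδ, hΦ0, hΦan, -, hroot, -⟩ := exists_fibreBranch Q N hN T hT hθ0 hTθ hT'θ
  refine ⟨Φ, hΦan, hΦ0, ?_⟩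
  have h1 : ∀ᶠ s in 𝓝 (0 : ℂ), ‖s‖ < δ := by
    filter_upwards [Metric.ball_mem_nhds (0 : ℂ) hδ] with s hs
    rwa [Metric.mem_ball, dist_zero_right] at hs
  filter_upwards [eventually_nhdsWithin_of_eventually_nhds h1, self_mem_nhdsWithin] with s hs hs0
  have h := hroot s hs hs0
  rw [hQ] at h
  rwa [pow_one, mul_comm]

/-! ## Part C. Every polynomial fibre: case ∧ dense -/

/-- **`S`-form along the place.**  `F` irreducible of positive `x₁`-degree; a place `x₀ = 1/s`,
`x₁ = Φ(s)/s` with `Φ(0) = a ∈ ℝ ∖ ℚ`; `R ∈ ℂ[x₀, x₁]` nonzero somewhere on the curve; `S` irreducible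
closed of dimension `≤ 2` containing `(x, R(x), e^{x₁})` for every `x` on the curve.  Then `S` has
Zariski-dense exponential points.
[cite: MantovaMasser2023, §1 Further remarks, p. 5 (the question, open in general)] (new) -/
theorem unprojectedDense_planeCurve_polyFibre_irrationalPlace (hFirr : Irreducible F)
    (hn : 1 ≤ F.natDegree) {Φ : ℂ → ℂ} (hΦan : AnalyticAt ℂ Φ 0) {a : ℝ} (ha : Irrational a)
    (hΦ0 : Φ 0 = a)
    (hplace : ∀ᶠ s in 𝓝[≠] (0 : ℂ),
      (F.map (Polynomial.evalRingHom (s ^ 1)⁻¹)).eval (Φ s * (s ^ 1)⁻¹) = 0)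
    (R : MvPolynomial (Fin 2) ℂ)
    (hR : ∃ x y : ℂ, (F.map (Polynomial.evalRingHom x)).eval y = 0 ∧ MvPolynomial.eval ![x, y] R ≠ 0)
    {S : Set (Fin 2 ⊕ Fin 2 → ℂ)} (hS : IsIrreducibleClosed ℂ S) (hdim : zariskiDim ℂ S ≤ (2 : ℕ))
    (hsub : ∀ x y : ℂ, (F.map (Polynomial.evalRingHom x)).eval y = 0 →
      (Sum.elim ![x, y] ![MvPolynomial.eval ![x, y] R, Complex.exp y] : Fin 2 ⊕ Fin 2 → ℂ) ∈ S) :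
    UnprojectedDense S := by
  classical
  obtain ⟨Φr, hΦr⟩ := exists_rowsEquiv
  have hndvd : ¬ F ∣ Φr R := by
    refine not_dvd_of_exists_eval_ne_zero F ?_
    obtain ⟨x, y, hxy, hne⟩ := hR
    exact ⟨x, y, hxy, by rw [← hΦr]; exact hne⟩
  obtain ⟨ψ, L, hψan, hψ0, hf⟩ :=
    exists_rows_place_normalForm F hFirr hn (Φr R) hndvd le_rfl 1 hΦan hplace
  refine unprojectedDense_branch_irrational_one hS hdim L hψan hψ0 hΦan ha hΦ0 ?_
  filter_upwards [hplace, hf] with s hs hfs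
  have hmem := hsub _ _ hs
  rwa [hΦr, hfs] at hmem

/-- **Mantova–Masser's question over a plane curve with a SIMPLE REAL IRRATIONAL asymptotic
direction: case ∧ dense for every polynomial fibre.**  `F ∈ ℂ[x₀][x₁]` irreducible of `x₁`-degree
`≥ 2`; `Q(s, t) = F(s, st)` with rows of degree `≤ N` and top row `T` (`= F_N(1, t)`); `a ∈ ℝ ∖ ℚ`
a simple root of `T`; `R` nonzero somewhere on the curve.  Then `{F = 0, y₀ = R(x₀, x₁)}` is an
irreducible surface with `dim π_add = 1`, on no vertical line, additively free, AND its exponential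
points are Zariski dense. [cite: MantovaMasser2023, §1 Further remarks, p. 5 (the question, open in
general)] (new) -/
theorem unprojectedDensityQuestion_planeCurve_polyFibre_irrationalAsymptote (hFirr : Irreducible F)
    (hn : 2 ≤ F.natDegree) (Q : ℂ[X][X])
    (hQ : ∀ s t : ℂ, (Q.map (Polynomial.evalRingHom s)).eval t =
      (F.map (Polynomial.evalRingHom s)).eval (s * t))
    (N : ℕ) (hN : ∀ j, (Q.coeff j).natDegree ≤ N) (T : ℂ[X]) (hT : ∀ j, T.coeff j = (Q.coeff j).coeff N)
    {a : ℝ} (ha : Irrational a) (hTa : T.IsRoot (a : ℂ)) (hT'a : (derivative T).eval (a : ℂ) ≠ 0)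
    (R : MvPolynomial (Fin 2) ℂ)
    (hR : ∃ x y : ℂ, (F.map (Polynomial.evalRingHom x)).eval y = 0 ∧ MvPolynomial.eval ![x, y] R ≠ 0) :
    MMCaseDimPiOneFree {w : Fin 2 ⊕ Fin 2 → ℂ |
        (F.map (Polynomial.evalRingHom (w (Sum.inl 0)))).eval (w (Sum.inl 1)) = 0 ∧
        w (Sum.inr 0) = MvPolynomial.eval ![w (Sum.inl 0), w (Sum.inl 1)] R} ∧
      UnprojectedDense {w : Fin 2 ⊕ Fin 2 → ℂ |
        (F.map (Polynomial.evalRingHom (w (Sum.inl 0)))).eval (w (Sum.inl 1)) = 0 ∧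
        w (Sum.inr 0) = MvPolynomial.eval ![w (Sum.inl 0), w (Sum.inl 1)] R} := by
  classical
  refine ⟨mmCase_planeCurve_polyFibre F hFirr hn R hR, ?_⟩
  have ha0 : (a : ℂ) ≠ 0 := by exact_mod_cast ha.ne_zero
  obtain ⟨Φ, hΦan, hΦ0, hplace⟩ := exists_place_of_simpleAsymptote F Q hQ N hN T hT ha0 hTa hT'a
  obtain ⟨Φr, hΦr⟩ := exists_rowsEquiv
  set A : MvPolynomial (Fin 2) ℂ := Φr.symm F with hA
  have hPQ : ∀ x y : ℂ, MvPolynomial.eval ![x, y] A = (F.map (Polynomial.evalRingHom x)).eval y := by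
    intro x y
    rw [hΦr, hA, RingEquiv.apply_symm_apply]
  have hirrA : Irreducible A := (irreducible_rows_iff hPQ).2 hFirr
  have hset : {w : Fin 2 ⊕ Fin 2 → ℂ |
      (F.map (Polynomial.evalRingHom (w (Sum.inl 0)))).eval (w (Sum.inl 1)) = 0 ∧
      w (Sum.inr 0) = MvPolynomial.eval ![w (Sum.inl 0), w (Sum.inl 1)] R} =
      {w : Fin 2 ⊕ Fin 2 → ℂ | MvPolynomial.eval ![w (Sum.inl 0), w (Sum.inl 1)] A = 0 ∧
        w (Sum.inr 0) = MvPolynomial.eval ![w (Sum.inl 0), w (Sum.inl 1)] R} := by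
    ext w
    simp only [Set.mem_setOf_eq, hPQ]
  rw [hset]
  refine unprojectedDense_planeCurve_polyFibre_irrationalPlace F hFirr (by omega) hΦan ha hΦ0 hplace
    R hR (isIrreducibleClosed_curveGraphFibre R hirrA) (le_of_eq (zariskiDim_curveGraphFibre R hirrA))
    fun x y hxy => ?_
  refine ⟨?_, ?_⟩
  · simp only [Sum.elim_inl, Matrix.cons_val_zero, Matrix.cons_val_one]
    rw [hPQ]
    exact hxy
  · simp only [Sum.elim_inr, Sum.elim_inl, Matrix.cons_val_zero, Matrix.cons_val_one]

/-! ## Part D. Rational fibres -/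

/-- **Rational fibres along an unramified real-irrational place.**  `F` irreducible of `x₁`-degree
`≥ 1`; a place `x₀ = 1/s`, `x₁ = Φ(s)/s` with `Φ(0) = a ∈ ℝ ∖ ℚ`; `R, Q ∈ ℂ[x₀, x₁]` nonzero
somewhere on the curve; `S` irreducible closed of dimension `≤ 2` containing `(x, R(x)/Q(x), e^{x₁})`
for all `x` on the curve with `Q(x) ≠ 0`.  Then `S` has Zariski-dense exponential points.
[cite: MantovaMasser2023, §1 Further remarks, p. 5 (the question, open in general)] (new) -/
theorem unprojectedDense_planeCurve_rationalFibre_irrationalPlace (hFirr : Irreducible F)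
    (hn : 1 ≤ F.natDegree) {Φ : ℂ → ℂ} (hΦan : AnalyticAt ℂ Φ 0) {a : ℝ} (ha : Irrational a)
    (hΦ0 : Φ 0 = a)
    (hplace : ∀ᶠ s in 𝓝[≠] (0 : ℂ),
      (F.map (Polynomial.evalRingHom (s ^ 1)⁻¹)).eval (Φ s * (s ^ 1)⁻¹) = 0)
    (R Q : MvPolynomial (Fin 2) ℂ)
    (hR : ∃ x y : ℂ, (F.map (Polynomial.evalRingHom x)).eval y = 0 ∧ MvPolynomial.eval ![x, y] R ≠ 0)
    (hQ : ∃ x y : ℂ, (F.map (Polynomial.evalRingHom x)).eval y = 0 ∧ MvPolynomial.eval ![x, y] Q ≠ 0)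
    {S : Set (Fin 2 ⊕ Fin 2 → ℂ)} (hS : IsIrreducibleClosed ℂ S) (hdim : zariskiDim ℂ S ≤ (2 : ℕ))
    (hsub : ∀ x y : ℂ, (F.map (Polynomial.evalRingHom x)).eval y = 0 →
      MvPolynomial.eval ![x, y] Q ≠ 0 →
      (Sum.elim ![x, y] ![MvPolynomial.eval ![x, y] R / MvPolynomial.eval ![x, y] Q, Complex.exp y] :
        Fin 2 ⊕ Fin 2 → ℂ) ∈ S) :
    UnprojectedDense S := by
  classical
  obtain ⟨Φr, hΦr⟩ := exists_rowsEquiv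
  have hndvdR : ¬ F ∣ Φr R := by
    refine not_dvd_of_exists_eval_ne_zero F ?_
    obtain ⟨x, y, hxy, hne⟩ := hR
    exact ⟨x, y, hxy, by rw [← hΦr]; exact hne⟩
  have hndvdQ : ¬ F ∣ Φr Q := by
    refine not_dvd_of_exists_eval_ne_zero F ?_
    obtain ⟨x, y, hxy, hne⟩ := hQ
    exact ⟨x, y, hxy, by rw [← hΦr]; exact hne⟩
  obtain ⟨ψR, LR, hψRan, hψR0, hfR⟩ :=
    exists_rows_place_normalForm F hFirr hn (Φr R) hndvdR le_rfl 1 hΦan hplace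
  obtain ⟨ψQ, LQ, hψQan, hψQ0, hfQ⟩ :=
    exists_rows_place_normalForm F hFirr hn (Φr Q) hndvdQ le_rfl 1 hΦan hplace
  have hψQne : ∀ᶠ s in 𝓝 (0 : ℂ), ψQ s ≠ 0 := hψQan.continuousAt.eventually_ne hψQ0
  refine unprojectedDense_branch_irrational_one hS hdim (LR - LQ) (hψRan.div hψQan hψQ0)
    (div_ne_zero hψR0 hψQ0) hΦan ha hΦ0 ?_
  filter_upwards [hplace, hfR, hfQ, self_mem_nhdsWithin, nhdsWithin_le_nhds hψQne] with s hs hsR hsQ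
    (hs0 : s ≠ 0) hψQs
  have hQne : MvPolynomial.eval ![(s ^ 1)⁻¹, Φ s * (s ^ 1)⁻¹] Q ≠ 0 := by
    rw [hΦr, hsQ]
    exact mul_ne_zero hψQs (zpow_ne_zero _ hs0)
  have hmem := hsub _ _ hs hQne
  have hval : MvPolynomial.eval ![(s ^ 1)⁻¹, Φ s * (s ^ 1)⁻¹] R /
      MvPolynomial.eval ![(s ^ 1)⁻¹, Φ s * (s ^ 1)⁻¹] Q = ψR s / ψQ s * s ^ (LR - LQ) := by
    rw [hΦr, hΦr, hsR, hsQ, zpow_sub₀ hs0]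
    field_simp
  rw [hval] at hmem
  exact hmem

end PlaneCurve

/-! ## Part E. Example: the hyperbola `x₁² = 2x₀² + 1` (asymptotic slopes `±√2`) -/

section Hyperbola

/-- Auxiliary computation for the example (`hyperbola_eval`). [folklore] -/
private theorem hyperbola_eval (x y : ℂ) :
    ((X ^ 2 - Polynomial.C (Polynomial.C 2 * X ^ 2 + 1 : ℂ[X]) : ℂ[X][X]).map
        (Polynomial.evalRingHom x)).eval y = y ^ 2 - (2 * x ^ 2 + 1) := by
  simp

/-- Auxiliary computation for the example (`hyperbola_natDegree`). [folklore] -/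
private theorem hyperbola_natDegree :
    (X ^ 2 - Polynomial.C (Polynomial.C 2 * X ^ 2 + 1 : ℂ[X]) : ℂ[X][X]).natDegree = 2 :=
  Polynomial.natDegree_X_pow_sub_C

/-- Auxiliary computation for the example (`hyperbola_monic`). [folklore] -/
private theorem hyperbola_monic :
    (X ^ 2 - Polynomial.C (Polynomial.C 2 * X ^ 2 + 1 : ℂ[X]) : ℂ[X][X]).Monic :=
  Polynomial.monic_X_pow_sub_C _ two_ne_zero

/-- `2s² + 1` is not a square in `ℂ[s]` (values `1, 3, 3` at `s = 0, 1, −1`). [folklore] -/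
private theorem two_X_sq_add_one_ne_sq (r : ℂ[X]) :
    (Polynomial.C 2 * X ^ 2 + 1 : ℂ[X]) ≠ r ^ 2 := by
  intro h
  have hdeg : (Polynomial.C 2 * X ^ 2 + 1 : ℂ[X]).natDegree = 2 := by compute_degree!
  have hr0 : r ≠ 0 := by
    rintro rfl
    rw [zero_pow two_ne_zero] at h
    rw [h, Polynomial.natDegree_zero] at hdeg
    exact two_ne_zero hdeg.symm
  have hr : r.natDegree = 1 := by
    have := congrArg Polynomial.natDegree h
    rw [hdeg, Polynomial.natDegree_pow] at this
    omega
  have hre := Polynomial.eq_X_add_C_of_natDegree_le_one hr.le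
  have ev : ∀ x : ℂ, 2 * x ^ 2 + 1 = (r.coeff 1 * x + r.coeff 0) ^ 2 := by
    intro x
    have := congrArg (Polynomial.eval x) h
    rw [hre] at this
    simpa using this
  have e0 := ev 0
  have e1 := ev 1
  have e2 := ev (-1)
  have h10 : r.coeff 1 * r.coeff 0 = 0 := by linear_combination (e2 - e1) / 4
  rcases mul_eq_zero.1 h10 with h1 | h0
  · rw [h1] at e1
    have : (2 : ℂ) = 0 := by linear_combination e1 - e0
    norm_num at this
  · rw [h0] at e0
    have : (1 : ℂ) = 0 := by linear_combination e0
    norm_num at this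

/-- `x₁² − (2x₀² + 1)` is irreducible in `ℂ[x₀][x₁]` (a monic quadratic with zero linear term is
reducible only if minus its constant term is a square). [folklore] -/
private theorem hyperbola_irreducible :
    Irreducible (X ^ 2 - Polynomial.C (Polynomial.C 2 * X ^ 2 + 1 : ℂ[X]) : ℂ[X][X]) := by
  set P : ℂ[X] := Polynomial.C 2 * X ^ 2 + 1 with hP
  have hF : (X ^ 2 - Polynomial.C P : ℂ[X][X]) = X ^ 2 + Polynomial.C (-P) := by
    rw [map_neg, sub_eq_add_neg]
  rw [hF]
  have hmonic : (X ^ 2 + Polynomial.C (-P) : ℂ[X][X]).Monic :=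
    Polynomial.monic_X_pow_add_C _ (by norm_num)
  have hdeg : (X ^ 2 + Polynomial.C (-P) : ℂ[X][X]).natDegree = 2 :=
    Polynomial.natDegree_X_pow_add_C
  by_contra hirr
  obtain ⟨c₁, c₂, hmul, hadd⟩ :=
    (hmonic.not_irreducible_iff_exists_add_mul_eq_coeff hdeg).1 hirr
  rw [Polynomial.coeff_add, Polynomial.coeff_X_pow, if_neg (by norm_num), zero_add,
    Polynomial.coeff_C_zero] at hmul
  rw [Polynomial.coeff_add, Polynomial.coeff_X_pow, if_neg (by norm_num), zero_add,
    Polynomial.coeff_C, if_neg (by norm_num)] at hadd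
  have hc₂ : c₂ = -c₁ := by linear_combination -hadd
  rw [hc₂] at hmul
  have hPsq : P = c₁ ^ 2 := by linear_combination -hmul
  exact two_X_sq_add_one_ne_sq c₁ hPsq

/-- The weighted polynomial `Q(s, t) = F(s, st) = s²t² − (2s² + 1)` of the hyperbola: its
coefficients. [folklore] -/
private theorem hyperbolaQ_coeff (j : ℕ) :
    (Polynomial.C (X ^ 2 : ℂ[X]) * X ^ 2 - Polynomial.C (Polynomial.C 2 * X ^ 2 + 1 : ℂ[X]) :
        ℂ[X][X]).coeff j =
      if j = 2 then X ^ 2 else if j = 0 then -(Polynomial.C 2 * X ^ 2 + 1) else 0 := by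
  simp only [Polynomial.coeff_sub, Polynomial.coeff_C_mul, Polynomial.coeff_X_pow,
    Polynomial.coeff_C]
  rcases j with _ | _ | _ | j <;> simp

/-- **`{x₁² = 2x₀² + 1, y₀ = R(x₀, x₁)}`: case ∧ dense for every `R` nonzero somewhere on the
hyperbola** — the simplest surface left open after gen 31 (asymptotic slopes `±√2`, real
irrational: no growth, no rational transport).  Top form `t² − 2`, simple root `√2`.
[cite: MantovaMasser2023, §1 Further remarks, p. 5 (the question, open in general)] (new) -/
theorem unprojectedDensityQuestion_hyperbolaSqrtTwo_polyFibre (R : MvPolynomial (Fin 2) ℂ)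
    (hR : ∃ x y : ℂ, y ^ 2 - (2 * x ^ 2 + 1) = 0 ∧ MvPolynomial.eval ![x, y] R ≠ 0) :
    MMCaseDimPiOneFree {w : Fin 2 ⊕ Fin 2 → ℂ |
        w (Sum.inl 1) ^ 2 - (2 * w (Sum.inl 0) ^ 2 + 1) = 0 ∧
        w (Sum.inr 0) = MvPolynomial.eval ![w (Sum.inl 0), w (Sum.inl 1)] R} ∧
      UnprojectedDense {w : Fin 2 ⊕ Fin 2 → ℂ |
        w (Sum.inl 1) ^ 2 - (2 * w (Sum.inl 0) ^ 2 + 1) = 0 ∧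
        w (Sum.inr 0) = MvPolynomial.eval ![w (Sum.inl 0), w (Sum.inl 1)] R} := by
  have hset : {w : Fin 2 ⊕ Fin 2 → ℂ |
      w (Sum.inl 1) ^ 2 - (2 * w (Sum.inl 0) ^ 2 + 1) = 0 ∧
      w (Sum.inr 0) = MvPolynomial.eval ![w (Sum.inl 0), w (Sum.inl 1)] R} =
      {w : Fin 2 ⊕ Fin 2 → ℂ |
        ((X ^ 2 - Polynomial.C (Polynomial.C 2 * X ^ 2 + 1 : ℂ[X]) : ℂ[X][X]).map
          (Polynomial.evalRingHom (w (Sum.inl 0)))).eval (w (Sum.inl 1)) = 0 ∧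
        w (Sum.inr 0) = MvPolynomial.eval ![w (Sum.inl 0), w (Sum.inl 1)] R} := by
    ext w; simp only [Set.mem_setOf_eq, hyperbola_eval]
  rw [hset]
  have hsqrt : ((Real.sqrt 2 : ℝ) : ℂ) ^ 2 = 2 := by
    rw [← Complex.ofReal_pow, Real.sq_sqrt (by norm_num : (0 : ℝ) ≤ 2)]
    push_cast
    rfl
  have hsqrt0 : ((Real.sqrt 2 : ℝ) : ℂ) ≠ 0 := by
    have : (0 : ℝ) < Real.sqrt 2 := Real.sqrt_pos.2 (by norm_num)
    exact_mod_cast this.ne'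
  refine unprojectedDensityQuestion_planeCurve_polyFibre_irrationalAsymptote _ hyperbola_irreducible
    (by rw [hyperbola_natDegree])
    (Polynomial.C (X ^ 2 : ℂ[X]) * X ^ 2 - Polynomial.C (Polynomial.C 2 * X ^ 2 + 1 : ℂ[X]))
    (fun s t => by simp; ring) 2 ?_ (X ^ 2 - Polynomial.C 2) ?_ irrational_sqrt_two ?_ ?_ R ?_
  · intro j
    rw [hyperbolaQ_coeff]
    split_ifs
    · simp
    · rw [Polynomial.natDegree_neg]; compute_degree!
    · simp
  · intro j
    rw [hyperbolaQ_coeff, Polynomial.coeff_sub, Polynomial.coeff_X_pow, Polynomial.coeff_C]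
    rcases j with _ | _ | _ | j <;> simp [Polynomial.coeff_one]
  · rw [Polynomial.IsRoot, Polynomial.eval_sub, Polynomial.eval_pow, Polynomial.eval_X,
      Polynomial.eval_C, hsqrt, sub_self]
  · rw [Polynomial.derivative_sub, Polynomial.derivative_X_pow, Polynomial.derivative_C, sub_zero,
      Polynomial.eval_mul, Polynomial.eval_C, Polynomial.eval_pow, Polynomial.eval_X]
    refine mul_ne_zero (by norm_num) ?_
    rw [show (2 : ℕ) - 1 = 1 from rfl, pow_one]
    exact hsqrt0
  · obtain ⟨x, y, hxy, hne⟩ := hR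
    exact ⟨x, y, by rw [hyperbola_eval]; exact hxy, hne⟩

/-- **`{x₁² = 2x₀² + 1, y₀ = x₀}`: case ∧ dense** (the point `(2, 3)` lies on the hyperbola).
[cite: MantovaMasser2023, §1 Further remarks, p. 5 (the question, open in general)] (new) -/
theorem unprojectedDensityQuestion_hyperbolaSqrtTwo_fibre_x₀ :
    MMCaseDimPiOneFree {w : Fin 2 ⊕ Fin 2 → ℂ |
        w (Sum.inl 1) ^ 2 - (2 * w (Sum.inl 0) ^ 2 + 1) = 0 ∧ w (Sum.inr 0) = w (Sum.inl 0)} ∧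
      UnprojectedDense {w : Fin 2 ⊕ Fin 2 → ℂ |
        w (Sum.inl 1) ^ 2 - (2 * w (Sum.inl 0) ^ 2 + 1) = 0 ∧ w (Sum.inr 0) = w (Sum.inl 0)} := by
  have h := unprojectedDensityQuestion_hyperbolaSqrtTwo_polyFibre (MvPolynomial.X 0)
    ⟨2, 3, by norm_num, by simp⟩
  simpa only [MvPolynomial.eval_X, Matrix.cons_val_one, Matrix.cons_val_zero] using h

end Hyperbola

end Summit.Schanuel.Schanuel.Theorems

end
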